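import Literature.AnabelianGeometry.SemiGraphs.SurfaceTypeCoverings
import Literature.GroupTheory.CombinatorialGroupTheory.PuncturedSurfaceGroupFiniteIndexAssembly
import Literature.GroupTheory.CombinatorialGroupTheory.RibbonGraphFaceSystems
import Literature.GroupTheory.CombinatorialGroupTheory.SchreierRibbonGraph
import HarnessLib

/-!
# [SemiAnbd] Example 2.10 / Remark 2.4.1, unconditionally: surface type is stable under finite étale
# coverings

Topic `Literature/AnabelianGeometry/SemiGraphs`.  `IsOfSurfaceType.of_isFiniteEtaleCoveringGlobal`
(`SurfaceTypeCoverings.lean`, seat abc-iut-w4-d089) takes the classical fact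
`PuncturedSurfaceGroupFiniteIndexSubgroup` (Hoare–Karrass–Solitar 1971 Thm 1 / ZVC LNM 835 Thm 4.14.1)
as a hypothesis; that fact is now PROVED — the assembly
`PuncturedSurfaceGroup.puncturedSurfaceGroupFiniteIndexSubgroup_of_shapes`
(`PuncturedSurfaceGroupFiniteIndexAssembly.lean`, seat abc-iut-w5-d195) fed with the Schreier layer
`exists_schreierRibbonGraph` (`SchreierRibbonGraph.lean`, seat abc-iut-w5-d186) and the normal-form
layer `RibbonGraph.exists_puncturedSurfaceGroup_mulEquiv_of_faceSystem` (`RibbonGraphFaceSystems.lean`,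
seat abc-iut-w5-d160); the same term is named `puncturedSurfaceGroupFiniteIndexSubgroup_holds` in
`PuncturedSurfaceGroupFiniteIndexSubgroupHolds.lean` — so the statement holds outright.  Theorem only.

## References

* S. Mochizuki, *Semi-graphs of anabelioids*, Publ. RIMS 42 (2006), Example 2.10 p.31, Remark 2.4.1.
  [MochizukiSemiAnbd2006]
-/

namespace Literature.AnabelianGeometry.SemiGraphs

namespace SemiGraphOfAnabelioids

open Literature.GroupTheory.CombinatorialGroupTheory

universe v₁ u₁ u

variable {𝒢 𝒢' : SemiGraphOfAnabelioids.{v₁, u₁, u}}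

/-- **[SemiAnbd] Example 2.10 / Remark 2.4.1, unconditional: a finite étale covering of a semi-graph
of anabelioids of surface type is of surface type.** [cite: MochizukiSemiAnbd2006, Ex. 2.10 p.31] -/
theorem IsOfSurfaceType.of_isFiniteEtaleCoveringGlobal_unconditional {Sigma : Set ℕ}
    (h𝒢 : 𝒢.IsOfSurfaceType Sigma) (φ : Hom 𝒢' 𝒢) (hφ : φ.IsFiniteEtaleCoveringGlobal) :
    𝒢'.IsOfSurfaceType Sigma :=
  IsOfSurfaceType.of_isFiniteEtaleCoveringGlobal
    (PuncturedSurfaceGroup.puncturedSurfaceGroupFiniteIndexSubgroup_of_shapes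
      (fun S hd hc hne htr K hK => exists_schreierRibbonGraph S hd hc hne htr K hK)
      (fun Fs h0 hd hc hne htr =>
        RibbonGraph.exists_puncturedSurfaceGroup_mulEquiv_of_faceSystem Fs h0 hd hc hne htr))
    h𝒢 φ hφ

end SemiGraphOfAnabelioids

end Literature.AnabelianGeometry.SemiGraphs
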